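import Summits.QuantumFields.BalabanUV.T4Continuum.E3Cert.ZL3d2AllU.Main
import Literature.MathematicalPhysics.QuantumFieldTheory.Balaban1983to89.B4GaugeCovariance

/-!
# Gaps / E3BlockL3d2Dictionary — the TREE-SIDE DICTIONARY for the E3 certificate package `ZL3d2AllU` ((d, L, k) = (2, 3, 1), ALL U):
# the lane polynomial `E3Z.zL3d2AllU_quadH` IS `9 * 2 ^ 20 · ⟨Φ, covOp Φ⟩` for the tree's covariant block operator `B4GaugeCovariance.covOp`
# ([B4] (1.3)–(1.6)) on the 3^2 block (9 sites, 12 in-block bonds, 4 non-tree SU(2) ≅ S³ links in the corner-taxi tree gauge, quaternion model on ℍ = ℝ⁴),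
# and the kernel certificate `E3Z.zL3d2AllU_nonneg` read in tree currency: `(511/512)·|Φ|² ≤ ⟨Φ, covOp Φ⟩` for EVERY unit-quaternion link configuration

HONEST FRAMING (cell pub-balaban-gaps, seat g1-p3; page 1 of everything): an IDENTIFICATION plus a READING — certified finite arithmetic on ONE small
block in d = 2, in the E3 lane's scalar-charged quaternion SURROGATE of Bałaban's covariant block operator ([Balaban1983RegularityDecay] = B4, CMP **89**
(1983), p. 572 (1.3)–(1.6); target shape (1.8) p. 573).  The lane's own docstrings leave «this H IS Bałaban's −Δ_U + aP(U) on the block» as a separate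
tree-side statement; this module supplies it for THIS package (siblings: `Gaps/E3BlockL2d2Dictionary`, `Gaps/E3BlockL2d4Dictionary`).  NOT Prop. (1.8)
(no Ω-assembly beyond the Neumann-decoupling remark, no k-tower), NOT an input of any NE row, NOT continuum, NOT Clay.

THE DICTIONARY (E3 conventions v0): sites `X = Fin 9` = lexicographic rank of the block's points; `ι = Fin 4` (ℍ); one coarse site `Y = Unit`; bond
weights `cL3d2 x y = η⁻² = 9` on the 12 bonds `bondsL3d2`, else `0`; link variables `WL3d2 X x y` = LEFT quaternion multiplication `Lq (linkAt X t)`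
on the 4 non-tree bonds (`freeIdx`, lane order, variables `4t..4t+3`), identity elsewhere (tree gauge); `q = η^d = 1/9`, `T = 1`, `m² = 0`,
`a′ = a·η^{−d} = 9`; test field `Φ (s, c) = X (16 + 4s + c)`.  THEOREM `quadH_eq_covOp_form` (polynomial identity in 52 variables, 308 monomials;
pre-checked outside the kernel at 12 random integer points against the tree literal, seat script `scripts/gen_allU.py`).  COROLLARY `covOp_coercive_L3d2`.
-/

namespace Summit.QuantumFields.BalabanUV.Gaps.E3BlockL3d2Dictionary

open E3Z
open scoped Matrix
open Literature.MathematicalPhysics.QuantumFieldTheory.Balaban1983to89.B4GaugeCovariance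

noncomputable section

/-! ## §1 The block data in the tree's vocabulary -/

/-- the 12 positively oriented in-block bonds `(b₋, b₊)` (site index = lexicographic rank). [cite: Balaban1983RegularityDecay, p. 572 (1.3)] -/
def bondsL3d2 : List (Fin 9 × Fin 9) :=
  [(0, 3), (0, 1), (1, 4), (1, 2), (2, 5), (3, 6), (3, 4), (4, 7), (4, 5), (5, 8), (6, 7), (7, 8)]

/-- bond weights: `η⁻² = 9` on the bonds, `0` otherwise. [cite: Balaban1983RegularityDecay, p. 572 (1.3)] -/
def cL3d2 : Fin 9 → Fin 9 → ℝ := fun x y => if (x, y) ∈ bondsL3d2 then 9 else 0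

/-- index of the free (non-tree) link on the ordered pair `(x, y)`, in the lane's order; `none` on tree bonds and non-bonds. [folklore] -/
def freeIdx : Fin 9 → Fin 9 → Option (Fin 4)
  | 1, 4 => some 0
  | 2, 5 => some 1
  | 4, 7 => some 2
  | 5, 8 => some 3
  | _, _ => none

/-- LEFT multiplication by the quaternion `u` on ℍ = ℝ⁴ (basis 1, i, j, k) — the lane's link action. [folklore] -/
def Lq (u : Fin 4 → ℝ) : Matrix (Fin 4) (Fin 4) ℝ :=
  !![u 0, -u 1, -u 2, -u 3; u 1, u 0, -u 3, u 2; u 2, u 3, u 0, -u 1; u 3, -u 2, u 1, u 0]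

/-- the lane's packing of link `t`: `(X (4t), …, X (4t+3))`. [folklore] -/
def linkAt (X : ℕ → ℝ) (t : Fin 4) : Fin 4 → ℝ := fun i => X (4 * (t : ℕ) + (i : ℕ))

/-- link variables in tree gauge: `Lq` of the free link on the non-tree bonds, identity on every other ordered pair. [cite: Balaban1983RegularityDecay, p. 572 (1.3)] -/
def WL3d2 (X : ℕ → ℝ) : Fin 9 → Fin 9 → Matrix (Fin 4) (Fin 4) ℝ :=
  fun x y => match freeIdx x y with
    | some t => Lq (linkAt X t)
    | none => 1

/-- block-averaging weights `q = η^d = 1/9`. [cite: Balaban1983RegularityDecay, p. 572 (1.4)] -/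
def qL3d2 : Unit → Fin 9 → ℝ := fun _ _ => 1 / 9

/-- transporters to the corner along the taxi tree: identity in tree gauge. [cite: Balaban1983RegularityDecay, p. 572 (1.4)] -/
def TL3d2 : Unit → Fin 9 → Matrix (Fin 4) (Fin 4) ℝ := fun _ _ => 1

/-- the lane's packing of the test field: `Φ (s, c) = X (16 + 4s + c)`. [folklore] -/
def fieldOf (X : ℕ → ℝ) : Fin 9 × Fin 4 → ℝ := fun p => X (16 + 4 * (p.1 : ℕ) + (p.2 : ℕ))

/-! ## §2 Coordinate lemmas -/

/-- a bond-supported weight sums over its bond list. [folklore] -/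
theorem sum_ite_mem_list {α : Type*} [Fintype α] [DecidableEq α] (L : List α) (hL : L.Nodup) (r : ℝ) (f : α → ℝ) :
    ∑ p, (if p ∈ L then r else 0) * f p = r * (L.map f).sum := by
  have h1 : ∀ p, (if p ∈ L then r else 0) * f p = if p ∈ L.toFinset then r * f p else 0 := by
    intro p
    by_cases h : p ∈ L
    · simp [h]
    · simp [h]
  simp_rw [h1]
  rw [Finset.sum_ite_mem, Finset.univ_inter, ← Finset.mul_sum, List.sum_toFinset _ hL]

set_option maxRecDepth 16384 in
/-- the double bond sum, as a list sum over the bonds. [folklore] -/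
theorem sum_cL3d2 (f : Fin 9 → Fin 9 → ℝ) :
    ∑ x, ∑ y, cL3d2 x y * f x y = 9 * (bondsL3d2.map fun p => f p.1 p.2).sum := by
  rw [← Fintype.sum_prod_type' (fun x y => cL3d2 x y * f x y)]
  exact sum_ite_mem_list bondsL3d2 (by decide) 9 (fun p => f p.1 p.2)

/-- free bond `(1,4)` carries link `0`. [folklore] -/
theorem W_free_0 (X : ℕ → ℝ) : WL3d2 X 1 4 = Lq (linkAt X 0) := by simp [WL3d2, freeIdx]
/-- free bond `(2,5)` carries link `1`. [folklore] -/
theorem W_free_1 (X : ℕ → ℝ) : WL3d2 X 2 5 = Lq (linkAt X 1) := by simp [WL3d2, freeIdx]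
/-- free bond `(4,7)` carries link `2`. [folklore] -/
theorem W_free_2 (X : ℕ → ℝ) : WL3d2 X 4 7 = Lq (linkAt X 2) := by simp [WL3d2, freeIdx]
/-- free bond `(5,8)` carries link `3`. [folklore] -/
theorem W_free_3 (X : ℕ → ℝ) : WL3d2 X 5 8 = Lq (linkAt X 3) := by simp [WL3d2, freeIdx]
/-- tree bond `(0,3)` carries the identity. [folklore] -/
theorem W_tree_0_3 (X : ℕ → ℝ) : WL3d2 X 0 3 = 1 := by simp [WL3d2, freeIdx]
/-- tree bond `(0,1)` carries the identity. [folklore] -/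
theorem W_tree_0_1 (X : ℕ → ℝ) : WL3d2 X 0 1 = 1 := by simp [WL3d2, freeIdx]
/-- tree bond `(1,2)` carries the identity. [folklore] -/
theorem W_tree_1_2 (X : ℕ → ℝ) : WL3d2 X 1 2 = 1 := by simp [WL3d2, freeIdx]
/-- tree bond `(3,6)` carries the identity. [folklore] -/
theorem W_tree_3_6 (X : ℕ → ℝ) : WL3d2 X 3 6 = 1 := by simp [WL3d2, freeIdx]
/-- tree bond `(3,4)` carries the identity. [folklore] -/
theorem W_tree_3_4 (X : ℕ → ℝ) : WL3d2 X 3 4 = 1 := by simp [WL3d2, freeIdx]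
/-- tree bond `(4,5)` carries the identity. [folklore] -/
theorem W_tree_4_5 (X : ℕ → ℝ) : WL3d2 X 4 5 = 1 := by simp [WL3d2, freeIdx]
/-- tree bond `(6,7)` carries the identity. [folklore] -/
theorem W_tree_6_7 (X : ℕ → ℝ) : WL3d2 X 6 7 = 1 := by simp [WL3d2, freeIdx]
/-- tree bond `(7,8)` carries the identity. [folklore] -/
theorem W_tree_7_8 (X : ℕ → ℝ) : WL3d2 X 7 8 = 1 := by simp [WL3d2, freeIdx]

/-- the squared norm of a covariant bond difference across a TREE bond, in coordinates. [folklore] -/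
theorem tree_term (Φ : Fin 9 × Fin 4 → ℝ) (x y : Fin 9) :
    (((1 : Matrix (Fin 4) (Fin 4) ℝ) *ᵥ fld Φ y - fld Φ x) ⬝ᵥ ((1 : Matrix (Fin 4) (Fin 4) ℝ) *ᵥ fld Φ y - fld Φ x)) =
      (Φ (y, 0) - Φ (x, 0)) ^ 2 + (Φ (y, 1) - Φ (x, 1)) ^ 2 + (Φ (y, 2) - Φ (x, 2)) ^ 2 + (Φ (y, 3) - Φ (x, 3)) ^ 2 := by
  simp only [Matrix.one_mulVec, dotProduct, Fin.sum_univ_four, Pi.sub_apply, fld_apply, Fin.isValue]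
  ring

/-- the squared norm of the covariant bond difference across a FREE bond, in coordinates. [folklore] -/
theorem free_term (u : Fin 4 → ℝ) (Φ : Fin 9 × Fin 4 → ℝ) (x y : Fin 9) :
    ((Lq u *ᵥ fld Φ y - fld Φ x) ⬝ᵥ (Lq u *ᵥ fld Φ y - fld Φ x)) =
      (u 0 * Φ (y, 0) - u 1 * Φ (y, 1) - u 2 * Φ (y, 2) - u 3 * Φ (y, 3) - Φ (x, 0)) ^ 2 +
      (u 1 * Φ (y, 0) + u 0 * Φ (y, 1) - u 3 * Φ (y, 2) + u 2 * Φ (y, 3) - Φ (x, 1)) ^ 2 +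
      (u 2 * Φ (y, 0) + u 3 * Φ (y, 1) + u 0 * Φ (y, 2) - u 1 * Φ (y, 3) - Φ (x, 2)) ^ 2 +
      (u 3 * Φ (y, 0) - u 2 * Φ (y, 1) + u 1 * Φ (y, 2) + u 0 * Φ (y, 3) - Φ (x, 3)) ^ 2 := by
  simp only [Lq, Matrix.mulVec, dotProduct, Fin.sum_univ_four, Pi.sub_apply, fld_apply, Fin.isValue, Matrix.of_apply,
    Matrix.cons_val', Matrix.cons_val_zero, Matrix.cons_val_one, Matrix.empty_val', Matrix.cons_val_fin_one, Matrix.cons_val]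
  ring

/-- the block average squared, in coordinates. [folklore] -/
theorem avg_term (Φ : Fin 9 × Fin 4 → ℝ) :
    (avgOp qL3d2 TL3d2 *ᵥ Φ) ⬝ᵥ (avgOp qL3d2 TL3d2 *ᵥ Φ) = ∑ i : Fin 4, ((1 / 9 : ℝ) * ∑ s : Fin 9, Φ (s, i)) ^ 2 := by
  have hA : ∀ i : Fin 4, (avgOp qL3d2 TL3d2 *ᵥ Φ) ((), i) = (1 / 9 : ℝ) * ∑ s : Fin 9, Φ (s, i) := by
    intro i
    have h := congrFun (fld_avgOp_mulVec qL3d2 TL3d2 Φ ()) i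
    simp only [fld_apply] at h
    rw [h]
    simp only [qL3d2, TL3d2, Matrix.one_mulVec, Finset.sum_apply, Pi.smul_apply, smul_eq_mul, fld_apply]
    rw [Finset.mul_sum]
  rw [dotProduct, Fintype.sum_prod_type, Finset.univ_unique, Finset.sum_singleton]
  refine Finset.sum_congr rfl fun i _ => ?_
  rw [show (default : Unit) = () from rfl, hA i, sq]

/-- **THE TREE OPERATOR'S QUADRATIC FORM IN COORDINATES** (12 bond terms + the averaging term). [cite: Balaban1983RegularityDecay, p. 572 (1.3)–(1.6)] -/
theorem covOp_form (X : ℕ → ℝ) (Φ : Fin 9 × Fin 4 → ℝ) :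
    Φ ⬝ᵥ (covOp cL3d2 0 9 qL3d2 (WL3d2 X) TL3d2 *ᵥ Φ) =
      9 * (((1 : Matrix (Fin 4) (Fin 4) ℝ) *ᵥ fld Φ 3 - fld Φ 0) ⬝ᵥ ((1 : Matrix (Fin 4) (Fin 4) ℝ) *ᵥ fld Φ 3 - fld Φ 0)) +
      9 * (((1 : Matrix (Fin 4) (Fin 4) ℝ) *ᵥ fld Φ 1 - fld Φ 0) ⬝ᵥ ((1 : Matrix (Fin 4) (Fin 4) ℝ) *ᵥ fld Φ 1 - fld Φ 0)) +
      9 * ((Lq (linkAt X 0) *ᵥ fld Φ 4 - fld Φ 1) ⬝ᵥ (Lq (linkAt X 0) *ᵥ fld Φ 4 - fld Φ 1)) +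
      9 * (((1 : Matrix (Fin 4) (Fin 4) ℝ) *ᵥ fld Φ 2 - fld Φ 1) ⬝ᵥ ((1 : Matrix (Fin 4) (Fin 4) ℝ) *ᵥ fld Φ 2 - fld Φ 1)) +
      9 * ((Lq (linkAt X 1) *ᵥ fld Φ 5 - fld Φ 2) ⬝ᵥ (Lq (linkAt X 1) *ᵥ fld Φ 5 - fld Φ 2)) +
      9 * (((1 : Matrix (Fin 4) (Fin 4) ℝ) *ᵥ fld Φ 6 - fld Φ 3) ⬝ᵥ ((1 : Matrix (Fin 4) (Fin 4) ℝ) *ᵥ fld Φ 6 - fld Φ 3)) +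
      9 * (((1 : Matrix (Fin 4) (Fin 4) ℝ) *ᵥ fld Φ 4 - fld Φ 3) ⬝ᵥ ((1 : Matrix (Fin 4) (Fin 4) ℝ) *ᵥ fld Φ 4 - fld Φ 3)) +
      9 * ((Lq (linkAt X 2) *ᵥ fld Φ 7 - fld Φ 4) ⬝ᵥ (Lq (linkAt X 2) *ᵥ fld Φ 7 - fld Φ 4)) +
      9 * (((1 : Matrix (Fin 4) (Fin 4) ℝ) *ᵥ fld Φ 5 - fld Φ 4) ⬝ᵥ ((1 : Matrix (Fin 4) (Fin 4) ℝ) *ᵥ fld Φ 5 - fld Φ 4)) +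
      9 * ((Lq (linkAt X 3) *ᵥ fld Φ 8 - fld Φ 5) ⬝ᵥ (Lq (linkAt X 3) *ᵥ fld Φ 8 - fld Φ 5)) +
      9 * (((1 : Matrix (Fin 4) (Fin 4) ℝ) *ᵥ fld Φ 7 - fld Φ 6) ⬝ᵥ ((1 : Matrix (Fin 4) (Fin 4) ℝ) *ᵥ fld Φ 7 - fld Φ 6)) +
      9 * (((1 : Matrix (Fin 4) (Fin 4) ℝ) *ᵥ fld Φ 8 - fld Φ 7) ⬝ᵥ ((1 : Matrix (Fin 4) (Fin 4) ℝ) *ᵥ fld Φ 8 - fld Φ 7)) +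
      9 * ((avgOp qL3d2 TL3d2 *ᵥ Φ) ⬝ᵥ (avgOp qL3d2 TL3d2 *ᵥ Φ)) := by
  rw [covOp, Matrix.add_mulVec, Matrix.add_mulVec, dotProduct_add, dotProduct_add, covLap_form, zero_smul,
    Matrix.zero_mulVec, dotProduct_zero, add_zero, Matrix.smul_mulVec, dotProduct_smul, projOp_form, smul_eq_mul, sum_cL3d2]
  simp only [bondsL3d2, List.map_cons, List.map_nil, List.sum_cons, List.sum_nil, W_free_0 X, W_free_1 X, W_free_2 X, W_free_3 X, W_tree_0_3 X, W_tree_0_1 X, W_tree_1_2 X, W_tree_3_6 X, W_tree_3_4 X, W_tree_4_5 X, W_tree_6_7 X, W_tree_7_8 X]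
  ring

/-! ## §3 The dictionary identity and the certificate in tree currency -/

set_option maxRecDepth 65536 in
set_option maxHeartbeats 4000000 in
/-- **THE LANE POLYNOMIAL IS THE TREE OPERATOR'S QUADRATIC FORM**: `Poly.eval X zL3d2AllU_quadH = 9 * 2 ^ 20 · ⟨Φ, covOp Φ⟩`, `Φ = fieldOf X`, links read off
`X` by `WL3d2 X`, for every real `X`. [cite: Balaban1983RegularityDecay, p. 572 (1.3)–(1.6)] -/
theorem quadH_eq_covOp_form (X : ℕ → ℝ) :
    Poly.eval X zL3d2AllU.quadH = 9 * 2 ^ 20 * (fieldOf X ⬝ᵥ (covOp cL3d2 0 9 qL3d2 (WL3d2 X) TL3d2 *ᵥ fieldOf X)) := by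
  rw [covOp_form]
  simp only [tree_term, free_term, avg_term]
  have hL : Poly.eval X zL3d2AllU.quadH = Poly.eval X zL3d2AllU_quadH := rfl
  rw [hL]
  simp only [zL3d2AllU_quadH, Poly.eval, Poly.evalMono, Int.cast_negSucc, pow_one, Fin.sum_univ_succ, Fin.sum_univ_zero,
    fieldOf, linkAt, Fin.isValue, Fin.coe_ofNat_eq_mod, Fin.val_succ]
  norm_num
  ring

/-- the first components of the package's sphere triples: `|x_t|² − 1`. [folklore] -/
theorem eq_map_fst : zL3d2AllU.eq.map Prod.fst =
    [[([], -1), ([(0, 2)], 1), ([(1, 2)], 1), ([(2, 2)], 1), ([(3, 2)], 1)], [([], -1), ([(4, 2)], 1), ([(5, 2)], 1), ([(6, 2)], 1), ([(7, 2)], 1)], [([], -1), ([(8, 2)], 1), ([(9, 2)], 1), ([(10, 2)], 1), ([(11, 2)], 1)], [([], -1), ([(12, 2)], 1), ([(13, 2)], 1), ([(14, 2)], 1), ([(15, 2)], 1)]] := by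
  rfl

/-- unit-quaternion links (`|u_t|² = 1`) give the package's `hsph`. [folklore] -/
theorem sphere_of_units (X : ℕ → ℝ)
    (hu : ∀ t : ℕ, t < 4 → X (4 * t) ^ 2 + X (4 * t + 1) ^ 2 + X (4 * t + 2) ^ 2 + X (4 * t + 3) ^ 2 = 1) :
    ∀ ew ∈ zL3d2AllU.eq, Poly.eval X ew.1 = 0 := by
  intro ew hew
  have hm : ew.1 ∈ zL3d2AllU.eq.map Prod.fst := List.mem_map.mpr ⟨ew, hew, rfl⟩
  rw [eq_map_fst] at hm
  have e0 := hu 0 (by norm_num)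
  have e1 := hu 1 (by norm_num)
  have e2 := hu 2 (by norm_num)
  have e3 := hu 3 (by norm_num)
  norm_num at e0 e1 e2 e3
  simp only [List.mem_cons, List.mem_nil_iff, or_false] at hm
  rcases hm with h|h|h|h <;>
    (rw [h]; simp only [Poly.eval, Poly.evalMono]; push_cast; linarith)

set_option maxRecDepth 16384 in
/-- the lane's `Σ v²` polynomial is `Φ ⬝ᵥ Φ`. [folklore] -/
theorem vSq_eq (X : ℕ → ℝ) :
    Poly.eval X ((List.range zL3d2AllU.dim).map (fun i => ([(zL3d2AllU.nx + i, 2)], (1 : ℤ)))) = fieldOf X ⬝ᵥ fieldOf X := by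
  simp only [zL3d2AllU, dotProduct, Fintype.sum_prod_type, Fin.sum_univ_succ, Fin.sum_univ_zero, fieldOf, List.range,
    List.range.loop, List.map, Poly.eval, Poly.evalMono, Fin.isValue, Fin.coe_ofNat_eq_mod, Fin.val_succ]
  norm_num
  ring

/-- **[B4] (1.8)-SHAPE COERCIVITY ON THE (2,3,1) BLOCK FOR EVERY SU(2) LINK CONFIGURATION, IN TREE CURRENCY** (kernel certificate `E3Z.zL3d2AllU_nonneg`
through the dictionary): unit-quaternion links ⇒ `(511/512)·(Φ ⬝ᵥ Φ) ≤ Φ ⬝ᵥ (covOp cL3d2 0 9 qL3d2 (WL3d2 X) TL3d2 *ᵥ Φ)` for every ℍ-valued field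
`Φ = fieldOf X` (`a = 1`; CENSUS-TABLE all-U row for (2,3,1)).  Certified computation; NOT Prop. (1.8). [cite: Balaban1983RegularityDecay, p. 573 (1.8)] -/
theorem covOp_coercive_L3d2 (X : ℕ → ℝ)
    (hu : ∀ t : ℕ, t < 4 → X (4 * t) ^ 2 + X (4 * t + 1) ^ 2 + X (4 * t + 2) ^ 2 + X (4 * t + 3) ^ 2 = 1) :
    (511 / 512 : ℝ) * (fieldOf X ⬝ᵥ fieldOf X) ≤ fieldOf X ⬝ᵥ (covOp cL3d2 0 9 qL3d2 (WL3d2 X) TL3d2 *ᵥ fieldOf X) := by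
  have h := zL3d2AllU_nonneg X (sphere_of_units X hu) (by simp [zL3d2AllU])
  rw [vSq_eq, quadH_eq_covOp_form] at h
  have hM : (zL3d2AllU.gamma : ℝ) = 9418752 := by norm_num [zL3d2AllU]
  rw [hM] at h
  nlinarith [h]

end

end Summit.QuantumFields.BalabanUV.Gaps.E3BlockL3d2Dictionary
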